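import Literature.Analysis.FluidPDE.RusinSverakBackwardRegularity
import HarnessLib

/-!
# Stability of singularities (Rusin–Šverák 2011, Lemma 2.1 = the named fact **L**) from the
pressure decay estimate and the one-scale criterion; **S** over the leaves `K`, `P2`, `oneScale`

Analysis/FluidPDE proof file (no new definitions, no new named facts) in the decomposition of the
named fact `Literature.Analysis.FluidPDE.rusin_sverak_leray_singular_points_stable` (**S**;
`RusinSverakLeraySolutions.lean`; Rusin–Šverák, J. Funct. Anal. 260 (2011) = arXiv:0911.0500,
Thm. 4.2 with Lemma 2.1), which `RusinSverakLerayStability.lean` proves from **K** (weak stability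
of `NS(u₀)`: Thm. 4.2 + Lemma 4.1 + Prop. 2.2), **L** (Lemma 2.1, stability of singularities) and
**B** (backward-cylinder regularity). **B** is proved in `RusinSverakBackwardRegularity.lean` from
the two Caffarelli–Kohn–Nirenberg leaves

* `seregin_sverak_pressure_decay` (**P2**; `PressureDecayEstimate.lean`; Seregin–Šverák 2009,
  (as13) in ball form): `D(ϱ; z) ≤ c [(ϱ/r) D(r; z) + (r/ϱ)² C(r; z)]`;
* `oneScaleRegularity` (`CKNEpsilonRegularityAssembly.lean`; Caffarelli–Kohn–Nirenberg 1982,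
  Prop. 1 = Rusin–Šverák's Prop. 2.1 at one scale): `C(r) + D(r) ≤ ε₀ ⟹ u ∈ L^∞(Q_{r/2})`;

and this file **proves L** from the same two leaves
(`rusin_sverak_stability_of_singularities_of_pressure_decay`), whence
`rusin_sverak_leray_singular_points_stable_of_pressure_decay : K → P2 → oneScaleRegularity → S`
and the restatement of Cor. 4.2 over these leaves. After this file the DAG below **S** reads:
**S** ⇐ **K** ∧ **P2** ∧ `oneScaleRegularity` (all reductions proved), **K** being the local Leray
theory (Lemma 4.1 + Prop. 2.2 + Thm. 4.2) and the two others standard ε-regularity inputs shared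
with the decomposition of ns.S12 (`ckn_epsilon_regularity_of_estimates`).

## The printed proof of Lemma 2.1 and the proof given here

Rusin–Šverák (arXiv:0911.0500 p. 4): "If the regularity criterion in Proposition 2.1 did not
contain the pressure `p`, the statement of the Lemma would be immediate: indeed, if `z₀` is a
regular point of `u`, then `r⁻² ∫_{Q_{z₀,r}} |u|³ = O(r³)` as `r → 0₊`. Choosing a sufficiently
small `r`, one sees that `r⁻² ∫_{Q_{z₀,r}} |u^k|³` is small for large `k` by the strong
convergence of `u^k` in `L³_{t,x}`. However, such argument cannot be applied to the pressure term,
since the sequence `p^k` may not have a subsequence which is compact in `L^{3/2}_{t,x}`. It is well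
known how to deal with this difficulty [...] decompose `p^k` as `p^k = p̃^k + h^k` with `p̃^k` [...]
(by Calderon-Zygmund estimates) and `h^k` bounded in `L^{3/2}_{t,x}(Q_{z₀,r})` and harmonic in `x`
[...] The term `h^k` is handled by using classical estimates for harmonic functions". The split
`p = p̃ + h` with its two estimates is exactly the content of the pressure decay estimate **P2**
(`PressureDecayEstimate.lean`, module docstring), and the proof below is the printed one with the
harmonic bookkeeping packaged in **P2** and iterated as in Seregin–Šverák 2009, p. 10:

suppose `|u| ≤ M` a.e. on `Q*_{ρ₀}(z₀)`, `z₀ = (t₀, x₀)`, fix a box `K ⊆ O` around `z₀` and the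
uniform bound `∫_K |p^k|^{3/2} ≤ C_p` of the situation of Prop. 2.2. With `θ` absorbing the
constant of **P2** (`c θ ≤ 1/2`), along the scales `s_j = θʲ r₀` at the shifted centre
`z' = (t₀ + h, x₀)`, `h = s_J²/8` (Robinson–Rodrigo–Sadowski 2016, Cor. 15.6), one has for every `k`
`D_k(s_J) ≤ 2^{-J} r₀⁻² C_p + 2 c θ⁻² e_k` as soon as `C_k(s_j) ≤ e_k`, `j < J`
(`cknD_iterate_le_of_pressure_decay`), and — this is the printed `u`-argument —
`C_k(s) ≤ 4 |B₁| M³ s³ + 4 s⁻² ∫_K |u^k - u|³` (`cknC_le_of_ae_bound_of_lintegral_sub`), so that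
`e_k = 4 |B₁| M³ r₀³ + 4 s_J⁻² ∫_K |u^k - u|³` works for all `j ≤ J`. Choosing `r₀` (first term),
`J` (pressure term), and then `k` large (strong `L³` convergence on `K`, and `z^k ∈ Q*_{√h}(z₀)`),
`C_k(s_J) + D_k(s_J) ≤ ε₀`, so `u^k ∈ L^∞(Q_{s_J/2}(z'))` by the one-scale criterion, and
`Q_{s_J/2}(z') ⊇ Q*_{√h}(z₀) ∋ z^k` makes `z^k` a regular point of `u^k` — a contradiction.

## Mathlib / tree search

Tree: the tools of `RusinSverakBackwardRegularity.lean` (`exists_ratio_mul_le_half`,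
`cknD_iterate_le_of_pressure_decay`, `volume_parabolicCylinder`, `setLIntegral_cube_le_of_ae_bound`,
`ae_enorm_le_eLpNorm_top`, `oneScaleRegularity.unforced`, `exists_forall_ofReal_pow_three_mul_le`,
`ENNReal.add_quarters_le`), `RusinSverak2011.CompactnessSituation` and **K**, **L**, **B**, **S**
(`RusinSverakLerayStability.lean`), the cylinder geometry of `CKN1982Setting.lean` /
`CKNEpsilonRegularity(Assembly).lean`. Mathlib: `ENNReal.rpow_add_le_mul_rpow_add_rpow`,
`lintegral_add_left`, `lintegral_const_mul'`, `Filter.Tendsto.eventually_mem`.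

## References

* W. Rusin, V. Šverák, J. Funct. Anal. 260 (2011) = arXiv:0911.0500: Prop. 2.1, Prop. 2.2,
  Lemma 2.1 and its proof (p. 4); Thm. 4.2, Cor. 4.2 (pp. 7–8).
* H. Jia, V. Šverák, SIAM J. Math. Anal. 45 (2013) = arXiv:1201.1592, Lemma 6 (= Lemma 2.1).
* G. Seregin, V. Šverák, Comm. PDE 34 (2009) = arXiv:0804.1803, proof of Lemma 3.5, (as13), p. 10.
* J. C. Robinson, J. L. Rodrigo, W. Sadowski, *The three-dimensional Navier–Stokes equations*
  (2016), Thm. 15.4, Cor. 15.6.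
-/

noncomputable section

open MeasureTheory Set Function Filter Topology TopologicalSpace Metric
open scoped NNReal ENNReal InnerProductSpace

namespace Literature.Analysis.FluidPDE


/-! ### The cubic term of the approximants: the printed `u`-argument -/

/-- `|a|³ ≤ 4 (|b|³ + |a - b|³)` in `ℝ≥0∞` (triangle inequality and convexity of `x ↦ x³`,
`(x + y)³ ≤ 2² (x³ + y³)`). [folklore] -/
theorem enorm_pow_three_le_four_mul (a b : (EuclideanSpace ℝ (Fin 3))) :
    ‖a‖ₑ ^ (3 : ℕ) ≤ 4 * (‖b‖ₑ ^ (3 : ℕ) + ‖a - b‖ₑ ^ (3 : ℕ)) := by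
  have h1 : ‖a‖ₑ ≤ ‖b‖ₑ + ‖a - b‖ₑ := by
    calc ‖a‖ₑ = ‖b + (a - b)‖ₑ := by congr 1; abel
      _ ≤ ‖b‖ₑ + ‖a - b‖ₑ := enorm_add_le _ _
  have h2 := ENNReal.rpow_add_le_mul_rpow_add_rpow ‖b‖ₑ ‖a - b‖ₑ (by norm_num : (1 : ℝ) ≤ 3)
  have e3 : ∀ x : ℝ≥0∞, x ^ (3 : ℝ) = x ^ (3 : ℕ) := fun x => by
    rw [show (3 : ℝ) = ((3 : ℕ) : ℝ) by norm_num, ENNReal.rpow_natCast]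
  have e4 : (2 : ℝ≥0∞) ^ ((3 : ℝ) - 1) = 4 := by
    rw [show (3 : ℝ) - 1 = ((2 : ℕ) : ℝ) by norm_num, ENNReal.rpow_natCast]
    norm_num
  rw [e3, e3, e3, e4] at h2
  calc ‖a‖ₑ ^ (3 : ℕ) ≤ (‖b‖ₑ + ‖a - b‖ₑ) ^ (3 : ℕ) := by gcongr
    _ ≤ 4 * (‖b‖ₑ ^ (3 : ℕ) + ‖a - b‖ₑ ^ (3 : ℕ)) := h2

/-- **The cubic quantity of an approximant near a regular point of the limit** (the printed
`u`-argument of Rusin–Šverák's proof of Lemma 2.1: "`r⁻² ∫_{Q_{z₀,r}} |u|³ = O(r³)` [...]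
`r⁻² ∫_{Q_{z₀,r}} |u^k|³` is small for large `k` by the strong convergence of `u^k` in `L³_{t,x}`").
If `‖u‖ₑ ≤ M` a.e. on a set `S ⊇ Q_s(z')` and `∫∫_K |v - u|³ ≤ T` for a set `K ⊇ Q_s(z')`, then
`C(s; z') ≤ 4 |B₁| M³ s³ + 4 s⁻² T` for the field `v`. No measurability of `u` or `v` is needed
(the bound `|v|³ ≤ 4(M³ + |v - u|³)` holds a.e., and a constant is measurable).
[cite: RusinSverak2011, proof of Lemma 2.1 (arXiv:0911.0500 p. 4)] -/
theorem cknC_le_of_ae_bound_of_lintegral_sub {v u : ℝ → (EuclideanSpace ℝ (Fin 3)) → (EuclideanSpace ℝ (Fin 3))} {S K : Set (ℝ × (EuclideanSpace ℝ (Fin 3)))}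
    {M T : ℝ≥0∞} {z' : ℝ × (EuclideanSpace ℝ (Fin 3))} {s : ℝ} (hs : 0 < s) (hQS : parabolicCylinder s z' ⊆ S)
    (hQK : parabolicCylinder s z' ⊆ K) (hb : ∀ᵐ w ∂(volume.restrict S), ‖u w.1 w.2‖ₑ ≤ M)
    (hT : ∫⁻ w in K, ‖v w.1 w.2 - u w.1 w.2‖ₑ ^ (3 : ℕ) ≤ T) :
    cknC s z' v ≤ 4 * (volume (ball (0 : (EuclideanSpace ℝ (Fin 3))) 1) * M ^ 3 * ENNReal.ofReal (s ^ 3)) +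
      4 * ((ENNReal.ofReal s ^ 2)⁻¹ * T) := by
  set Q := parabolicCylinder s z' with hQ
  have hint : ∫⁻ w in Q, ‖v w.1 w.2‖ₑ ^ (3 : ℕ) ≤
      4 * (M ^ 3 * volume Q) + 4 * ∫⁻ w in Q, ‖v w.1 w.2 - u w.1 w.2‖ₑ ^ (3 : ℕ) := by
    calc ∫⁻ w in Q, ‖v w.1 w.2‖ₑ ^ (3 : ℕ)
        ≤ ∫⁻ w in Q, (4 * M ^ 3 + 4 * ‖v w.1 w.2 - u w.1 w.2‖ₑ ^ (3 : ℕ)) := by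
          refine lintegral_mono_ae ?_
          filter_upwards [ae_restrict_of_ae_restrict_of_subset hQS hb] with w hw
          calc ‖v w.1 w.2‖ₑ ^ (3 : ℕ)
              ≤ 4 * (‖u w.1 w.2‖ₑ ^ (3 : ℕ) + ‖v w.1 w.2 - u w.1 w.2‖ₑ ^ (3 : ℕ)) :=
                enorm_pow_three_le_four_mul _ _
            _ ≤ 4 * (M ^ 3 + ‖v w.1 w.2 - u w.1 w.2‖ₑ ^ (3 : ℕ)) := by gcongr
            _ = 4 * M ^ 3 + 4 * ‖v w.1 w.2 - u w.1 w.2‖ₑ ^ (3 : ℕ) := mul_add _ _ _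
      _ = (∫⁻ _ in Q, 4 * M ^ 3) + ∫⁻ w in Q, 4 * ‖v w.1 w.2 - u w.1 w.2‖ₑ ^ (3 : ℕ) :=
          lintegral_add_left measurable_const _
      _ = 4 * (M ^ 3 * volume Q) + 4 * ∫⁻ w in Q, ‖v w.1 w.2 - u w.1 w.2‖ₑ ^ (3 : ℕ) := by
          rw [setLIntegral_const, lintegral_const_mul' _ _ ENNReal.ofNat_ne_top, mul_assoc]
  have hsub : ∫⁻ w in Q, ‖v w.1 w.2 - u w.1 w.2‖ₑ ^ (3 : ℕ) ≤ T := (lintegral_mono_set hQK).trans hT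
  rw [cknC]
  calc (ENNReal.ofReal s ^ 2)⁻¹ * ∫⁻ w in Q, ‖v w.1 w.2‖ₑ ^ (3 : ℕ)
      ≤ (ENNReal.ofReal s ^ 2)⁻¹ * (4 * (M ^ 3 * volume Q) + 4 * T) := by
        gcongr
        exact hint.trans (by gcongr)
    _ = 4 * (volume (ball (0 : (EuclideanSpace ℝ (Fin 3))) 1) * M ^ 3 * ((ENNReal.ofReal s ^ 2)⁻¹ * ENNReal.ofReal (s ^ 5))) +
          4 * ((ENNReal.ofReal s ^ 2)⁻¹ * T) := by
        rw [hQ, volume_parabolicCylinder hs z']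
        ring
    _ = _ := by rw [inv_ofReal_sq_mul_ofReal_pow_five hs]

/-! ### Geometry: shifted cylinders near `z₀` -/

/-- Shifted backward cylinders `Q_r(t₀ + h, x₀)` with `0 ≤ h ≤ r²`, `r ≤ ρ` lie in the centred
cylinder `Q*_ρ(t₀, x₀)` (through `Q*_r ⊆ Q*_ρ`). [folklore] -/
theorem parabolicCylinder_shift_subset_centered_of_le {r ρ h : ℝ} (h0 : 0 ≤ h) (hhr : h ≤ r ^ 2)
    (hr : 0 ≤ r) (hrρ : r ≤ ρ) (z : ℝ × (EuclideanSpace ℝ (Fin 3))) :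
    parabolicCylinder r (z.1 + h, z.2) ⊆ parabolicCylinderCentered ρ z := by
  refine (parabolicCylinder_shift_subset_centered h0 hhr z).trans ?_
  have h2 : r ^ 2 ≤ ρ ^ 2 := pow_le_pow_left₀ hr hrρ 2
  exact prod_mono (Ioo_subset_Ioo (by linarith) (by linarith)) (ball_subset_ball hrρ)

/-- A field essentially bounded on an open set is regular at each of its points
(`IsRegularPoint`: a small centred cylinder fits inside the open set). [folklore] -/
theorem isRegularPoint_of_mem_of_eLpNorm_lt_top {v : ℝ → (EuclideanSpace ℝ (Fin 3)) → (EuclideanSpace ℝ (Fin 3))} {W : Set (ℝ × (EuclideanSpace ℝ (Fin 3)))}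
    (hW : IsOpen W) {w : ℝ × (EuclideanSpace ℝ (Fin 3))} (hw : w ∈ W)
    (hb : eLpNorm (uncurry v) ∞ (volume.restrict W) < ∞) : IsRegularPoint v w := by
  obtain ⟨r, hr, -, hbox⟩ := exists_closedCylinder_subset hW hw
  have hsub : parabolicCylinderCentered r w ⊆ W :=
    (parabolicCylinderCentered_subset_closedCylinder r w).trans hbox
  exact ⟨r, hr, lt_of_le_of_lt (eLpNorm_mono_measure _ (Measure.restrict_mono hsub le_rfl)) hb⟩

/-! ### Lemma 2.1 from the pressure decay estimate and the one-scale criterion -/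

/-- **Rusin–Šverák's Lemma 2.1 from the pressure decay estimate and an unforced one-scale
criterion** (core of `rusin_sverak_stability_of_singularities_of_pressure_decay`, the
ε-regularity input abstracted to its unforced one-scale shape so that it can be fed either by
`oneScaleRegularity` (`oneScaleRegularity.unforced`) or by Lemarié-Rieusset's Thm. 14.4
(`lemarieRieusset_epsilon_regularity`)). Proof: module docstring.
[cite: RusinSverak2011, Lemma 2.1 and its proof (arXiv:0911.0500 p. 4); = JiaSverak2013 Lemma 6] -/
theorem rusin_sverak_stability_of_singularities_of_unforced
    (hPD : seregin_sverak_pressure_decay)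
    (hU : ∃ ε₀ : ℝ, 0 < ε₀ ∧ ∀ (O : Opens (ℝ × (EuclideanSpace ℝ (Fin 3)))) (u : ℝ → (EuclideanSpace ℝ (Fin 3)) → (EuclideanSpace ℝ (Fin 3))) (p : ℝ → (EuclideanSpace ℝ (Fin 3)) → ℝ),
      IsSuitableWeakSolutionOn O 1 0 u p → ∀ (z : ℝ × (EuclideanSpace ℝ (Fin 3))) (r : ℝ), 0 < r →
        closure (parabolicCylinder r z) ⊆ (O : Set (ℝ × (EuclideanSpace ℝ (Fin 3)))) →
        cknC r z u + cknD r z p ≤ ENNReal.ofReal ε₀ →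
        eLpNorm (uncurry u) ∞ (volume.restrict (parabolicCylinder (r / 2) z)) < ∞) :
    rusin_sverak_stability_of_singularities := by
  intro O useq pseq u p hsit z z₀ hzO hz₀ hsing hz hreg
  obtain ⟨ρ₀, hρ₀, hbdd⟩ := hreg
  obtain ⟨c, hPD⟩ := hPD.ratio
  obtain ⟨ε₀, hε₀, hOS⟩ := hU
  obtain ⟨θ, hθ, hθhalf, hcθ⟩ := exists_ratio_mul_le_half c
  have hθ1 : θ ≤ 1 := hθhalf.trans (by norm_num)
  -- the essential bound of the limit near `z₀`
  set M : ℝ≥0∞ := eLpNorm (uncurry u) ∞ (volume.restrict (parabolicCylinderCentered ρ₀ z₀)) with hMdef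
  have hM : ∀ᵐ w ∂(volume.restrict (parabolicCylinderCentered ρ₀ z₀)), ‖u w.1 w.2‖ₑ ≤ M :=
    ae_enorm_le_eLpNorm_top u _
  have hMtop : M ≠ ∞ := hbdd.ne
  -- a closed box `K` around `z₀` inside `O`, of size `r₁ ≤ ρ₀/2`
  obtain ⟨r₂, hr₂, -, hKO₂⟩ := exists_closedCylinder_subset O.isOpen hz₀
  set r₁ : ℝ := min r₂ (ρ₀ / 2) with hr₁def
  have hr₁ : 0 < r₁ := lt_min hr₂ (by positivity)
  have hr₁ρ : r₁ ≤ ρ₀ / 2 := min_le_right _ _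
  set K : Set (ℝ × (EuclideanSpace ℝ (Fin 3))) := Icc (z₀.1 - r₁ ^ 2) (z₀.1 + r₁ ^ 2) ×ˢ closedBall z₀.2 r₁ with hKdef
  have hKO : K ⊆ (O : Set (ℝ × (EuclideanSpace ℝ (Fin 3)))) := by
    have : r₁ ^ 2 ≤ r₂ ^ 2 := pow_le_pow_left₀ hr₁.le (min_le_left _ _) 2
    exact Subset.trans (prod_mono (Icc_subset_Icc (by linarith) (by linarith))
      (closedBall_subset_closedBall (min_le_left _ _))) hKO₂
  have hKc : IsCompact K := isCompact_Icc.prod (isCompact_closedBall _ _)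
  -- uniform data of the situation of Prop. 2.2 on `K`
  obtain ⟨Cp, hCp⟩ := hsit.pressure_bound K hKO hKc
  have hT := hsit.tendsto_lintegral K hKO hKc
  -- cylinders `Q_r(t₀ + h, x₀)` with `0 ≤ h ≤ r₁²`, `0 < r ≤ r₁` lie in the box
  have hbox : ∀ h r, 0 ≤ h → h ≤ r₁ ^ 2 → 0 < r → r ≤ r₁ →
      closure (parabolicCylinder r (z₀.1 + h, z₀.2)) ⊆ K :=
    fun h r h0 hh hr hrr => closure_parabolicCylinder_shift_subset_box h0 hh hr hrr z₀
  -- constants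
  set V₁ : ℝ≥0∞ := volume (ball (0 : (EuclideanSpace ℝ (Fin 3))) 1) with hV₁
  have hV₁top : V₁ ≠ ∞ := measure_ball_lt_top.ne
  set Θ : ℝ≥0∞ := ENNReal.ofReal ((θ⁻¹) ^ 2) with hΘ
  set L : ℝ≥0∞ := 1 + 2 * ((c : ℝ≥0∞) * Θ) with hL
  have hLtop : L ≠ ∞ := ENNReal.add_ne_top.2 ⟨ENNReal.one_ne_top,
    ENNReal.mul_ne_top ENNReal.ofNat_ne_top (ENNReal.mul_ne_top ENNReal.coe_ne_top ENNReal.ofReal_ne_top)⟩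
  set ε : ℝ≥0∞ := ENNReal.ofReal ε₀ with hεdef
  have hε4 : 0 < ε / 4 := ENNReal.div_pos (ENNReal.ofReal_pos.2 hε₀).ne' ENNReal.ofNat_ne_top
  -- (A) the radius `r₀ ≤ r₁`: `L · 4 |B₁| M³ r₀³ ≤ ε/4`
  obtain ⟨rA, hrA, hA⟩ := exists_forall_ofReal_pow_three_mul_le (N := L * (4 * (V₁ * M ^ 3)))
    (ENNReal.mul_ne_top hLtop (ENNReal.mul_ne_top ENNReal.ofNat_ne_top
      (ENNReal.mul_ne_top hV₁top (ENNReal.pow_ne_top hMtop)))) hε4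
  set r₀ : ℝ := min r₁ rA with hr₀def
  have hr₀ : 0 < r₀ := lt_min hr₁ hrA
  have hr₀r₁ : r₀ ≤ r₁ := min_le_left _ _
  have hr₀ρ : r₀ ≤ ρ₀ := by linarith
  have hAr₀ : ENNReal.ofReal (r₀ ^ 3) * (L * (4 * (V₁ * M ^ 3))) ≤ ε / 4 := hA r₀ hr₀ (min_le_right _ _)
  -- (B) the number of steps `J`
  set P : ℝ≥0∞ := (ENNReal.ofReal r₀ ^ 2)⁻¹ * Cp with hPdef
  have hPtop : P ≠ ∞ :=
    ENNReal.mul_ne_top (ENNReal.inv_ne_top.2 (pow_ne_zero 2 (ENNReal.ofReal_pos.2 hr₀).ne')) ENNReal.coe_ne_top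
  obtain ⟨J, hJ⟩ := exists_inv_two_pow_mul_le hPtop hε4
  -- the final scale `s = θᴶ r₀`, the shift `h = s²/8`, the centre `z'`
  set s : ℝ := θ ^ J * r₀ with hsdef
  have hs : 0 < s := by positivity
  have hsr₀ : s ≤ r₀ := mul_le_of_le_one_left hr₀.le (pow_le_one₀ hθ.le hθ1)
  have hscale0 : ∀ j : ℕ, 0 < θ ^ j * r₀ := fun j => by positivity
  have hscale1 : ∀ j : ℕ, θ ^ j * r₀ ≤ r₀ := fun j =>
    mul_le_of_le_one_left hr₀.le (pow_le_one₀ hθ.le hθ1)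
  have hscale2 : ∀ j ≤ J, s ≤ θ ^ j * r₀ := fun j hj =>
    mul_le_mul_of_nonneg_right (pow_le_pow_of_le_one hθ.le hθ1 hj) hr₀.le
  set h : ℝ := s ^ 2 / 8 with hhdef
  have hh0 : 0 < h := by positivity
  have hhs : h ≤ s ^ 2 / 8 := le_rfl
  have hhs' : ∀ j ≤ J, h ≤ (θ ^ j * r₀) ^ 2 := fun j hj => by
    have : s ^ 2 ≤ (θ ^ j * r₀) ^ 2 := pow_le_pow_left₀ hs.le (hscale2 j hj) 2
    rw [hhdef]; nlinarith
  have hhr₁ : h ≤ r₁ ^ 2 := by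
    have : s ^ 2 ≤ r₁ ^ 2 := pow_le_pow_left₀ hs.le (hsr₀.trans hr₀r₁) 2
    rw [hhdef]; nlinarith
  set z' : ℝ × (EuclideanSpace ℝ (Fin 3)) := (z₀.1 + h, z₀.2) with hz'
  have hclK : ∀ r, 0 < r → r ≤ r₀ → closure (parabolicCylinder r z') ⊆ K :=
    fun r hr hrr => hbox h r hh0.le hhr₁ hr (hrr.trans hr₀r₁)
  have hclO : ∀ r, 0 < r → r ≤ r₀ → closure (parabolicCylinder r z') ⊆ (O : Set (ℝ × (EuclideanSpace ℝ (Fin 3)))) :=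
    fun r hr hrr => (hclK r hr hrr).trans hKO
  -- the regular neighbourhood `Q*_{√h}(z₀) ⊆ Q_{s/2}(z')` and the events in `k`
  have hevT : ∀ᶠ k : ℕ in atTop, L * (4 * ((ENNReal.ofReal s ^ 2)⁻¹ *
      ∫⁻ w in K, ‖useq k w.1 w.2 - u w.1 w.2‖ₑ ^ (3 : ℕ))) ≤ ε / 4 := by
    have hfin : L * (4 * (ENNReal.ofReal s ^ 2)⁻¹) ≠ ∞ :=
      ENNReal.mul_ne_top hLtop (ENNReal.mul_ne_top ENNReal.ofNat_ne_top
        (ENNReal.inv_ne_top.2 (pow_ne_zero 2 (ENNReal.ofReal_pos.2 hs).ne')))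
    have h1 := ENNReal.Tendsto.const_mul hT (Or.inr hfin)
    rw [mul_zero] at h1
    have h2 : Tendsto (fun k : ℕ => L * (4 * ((ENNReal.ofReal s ^ 2)⁻¹ *
        ∫⁻ w in K, ‖useq k w.1 w.2 - u w.1 w.2‖ₑ ^ (3 : ℕ)))) atTop (𝓝 0) := by
      refine h1.congr fun k => ?_
      simp only [mul_assoc]
    exact h2.eventually (ge_mem_nhds hε4)
  set ρ : ℝ := Real.sqrt h with hρdef
  have hρ : 0 < ρ := Real.sqrt_pos.2 hh0
  have hevz : ∀ᶠ k : ℕ in atTop, z k ∈ parabolicCylinderCentered ρ z₀ :=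
    hz.eventually_mem ((isOpen_parabolicCylinderCentered ρ z₀).mem_nhds
      (self_mem_parabolicCylinderCentered hρ z₀))
  obtain ⟨k, hkT, hkz⟩ := (hevT.and hevz).exists
  -- the cubic inputs of the approximant `u^k`
  set T : ℝ≥0∞ := ∫⁻ w in K, ‖useq k w.1 w.2 - u w.1 w.2‖ₑ ^ (3 : ℕ) with hTdef
  set e : ℝ≥0∞ := 4 * (V₁ * M ^ 3 * ENNReal.ofReal (r₀ ^ 3)) + 4 * ((ENNReal.ofReal s ^ 2)⁻¹ * T)
    with hedef
  have hCe : ∀ j ≤ J, cknC (θ ^ j * r₀) z' (useq k) ≤ e := by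
    intro j hj
    have hQS : parabolicCylinder (θ ^ j * r₀) z' ⊆ parabolicCylinderCentered ρ₀ z₀ :=
      parabolicCylinder_shift_subset_centered_of_le hh0.le (hhs' j hj) (hscale0 j).le
        ((hscale1 j).trans hr₀ρ) z₀
    have hQK : parabolicCylinder (θ ^ j * r₀) z' ⊆ K := subset_closure.trans (hclK _ (hscale0 j) (hscale1 j))
    refine (cknC_le_of_ae_bound_of_lintegral_sub (hscale0 j) hQS hQK hM le_rfl).trans ?_
    have h1 : ENNReal.ofReal ((θ ^ j * r₀) ^ 3) ≤ ENNReal.ofReal (r₀ ^ 3) :=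
      ENNReal.ofReal_le_ofReal (pow_le_pow_left₀ (hscale0 j).le (hscale1 j) 3)
    have h2 : (ENNReal.ofReal (θ ^ j * r₀) ^ 2)⁻¹ ≤ (ENNReal.ofReal s ^ 2)⁻¹ :=
      ENNReal.inv_le_inv.2 (pow_le_pow_left' (ENNReal.ofReal_le_ofReal (hscale2 j hj)) 2)
    exact add_le_add (mul_le_mul_right (mul_le_mul_right h1 (V₁ * M ^ 3)) 4)
      (mul_le_mul_right (mul_le_mul_left h2 T) 4)
  -- the pressure of the approximant at the last scale
  have hD : cknD s z' (pseq k) ≤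
      (2⁻¹ : ℝ≥0∞) ^ J * cknD r₀ z' (pseq k) + 2 * ((c : ℝ≥0∞) * Θ * e) :=
    cknD_iterate_le_of_pressure_decay hPD hθ hθ1 hcθ (hsit.suitable k).distributional hr₀
      (subset_closure.trans (hclO r₀ hr₀ le_rfl)) (fun j hj => hCe j hj.le)
  have hD0 : cknD r₀ z' (pseq k) ≤ P :=
    (cknD_le_of_subset (pseq k) (subset_closure.trans (hclK r₀ hr₀ le_rfl))).trans
      (mul_le_mul_right (hCp k) _)
  -- smallness and the one-scale criterion for `(u^k, p^k)`
  have hsmall : cknC s z' (useq k) + cknD s z' (pseq k) ≤ ε := by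
    have h1 : cknC s z' (useq k) ≤ e := hCe J le_rfl
    have h2 : L * e ≤ ε / 4 + ε / 4 := by
      rw [hedef, mul_add]
      refine add_le_add ?_ hkT
      calc L * (4 * (V₁ * M ^ 3 * ENNReal.ofReal (r₀ ^ 3)))
          = ENNReal.ofReal (r₀ ^ 3) * (L * (4 * (V₁ * M ^ 3))) := by ring
        _ ≤ ε / 4 := hAr₀
    have h3 : (2⁻¹ : ℝ≥0∞) ^ J * cknD r₀ z' (pseq k) ≤ ε / 4 := le_trans (by gcongr) hJ
    calc cknC s z' (useq k) + cknD s z' (pseq k)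
        ≤ e + ((2⁻¹ : ℝ≥0∞) ^ J * cknD r₀ z' (pseq k) + 2 * ((c : ℝ≥0∞) * Θ * e)) :=
          add_le_add h1 hD
      _ = L * e + (2⁻¹ : ℝ≥0∞) ^ J * cknD r₀ z' (pseq k) := by rw [hL]; ring
      _ ≤ (ε / 4 + ε / 4) + ε / 4 := add_le_add h2 h3
      _ ≤ ε := ENNReal.add_quarters_le ε
  have hbk := hOS O (useq k) (pseq k) (hsit.suitable k) z' s hs (hclO s hs hsr₀) hsmall
  -- `z^k` is then a regular point of `u^k`: contradiction
  have hρ2 : ρ ^ 2 = h := Real.sq_sqrt hh0.le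
  have hsub : parabolicCylinderCentered ρ z₀ ⊆ parabolicCylinder (s / 2) z' := by
    refine parabolicCylinderCentered_subset_shift ?_ hρ2.le ?_ z₀
    · have h1 : h ≤ (s / 2) ^ 2 := by rw [hhdef]; nlinarith
      calc ρ = Real.sqrt h := hρdef
        _ ≤ Real.sqrt ((s / 2) ^ 2) := Real.sqrt_le_sqrt h1
        _ = s / 2 := Real.sqrt_sq (by linarith)
    · rw [hρ2, hhdef]; nlinarith
  exact hsing k (isRegularPoint_of_mem_of_eLpNorm_lt_top (isOpen_parabolicCylinder _ _)
    (hsub hkz) hbk)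

/-- **Rusin–Šverák's Lemma 2.1 (`L = rusin_sverak_stability_of_singularities`) from the pressure
decay estimate (P2) and the one-scale ε-regularity criterion** (arXiv:0911.0500 p. 4, Lemma 2.1:
"In the situation of Proposition 2.2, assume that `z^k ∈ 𝒪` are singular points of `(u^k, p^k)`,
`k = 1, 2, …`, and that `z^k → z₀ ∈ 𝒪`. Then `z₀` is a singular point of `(u, p)`"; = Jia–Šverák
2013, Lemma 6). Proof: module docstring — if `u` were bounded near `z₀`, the cubic quantities of
the approximants would be small at all scales `θʲ r₀`, `j ≤ J`, near `z₀` for large `k` (strong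
`L³` convergence; `cknC_le_of_ae_bound_of_lintegral_sub`), the pressure decay estimate iterated
`J` times at the shifted centre `(t₀ + s_J²/8, x₀)` would make `D_k(s_J)` small uniformly in `k`
(uniform `L^{3/2}` bound of the situation of Prop. 2.2), and the one-scale criterion would bound
`u^k` on `Q_{s_J/2}(t₀ + s_J²/8, x₀) ⊇ Q*_{s_J/(2√2)}(z₀) ∋ z^k`, contradicting the singularity of
`z^k`. [cite: RusinSverak2011, Lemma 2.1 and its proof (arXiv:0911.0500 p. 4); = JiaSverak2013 Lemma 6] -/
theorem rusin_sverak_stability_of_singularities_of_pressure_decay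
    (hPD : seregin_sverak_pressure_decay) (hOS : oneScaleRegularity) :
    rusin_sverak_stability_of_singularities :=
  rusin_sverak_stability_of_singularities_of_unforced hPD hOS.unforced

/-- **S from K, the pressure decay estimate and an unforced one-scale criterion** (core of
`rusin_sverak_leray_singular_points_stable_of_pressure_decay`; the ε-regularity input in its
unforced one-scale shape). [cite: RusinSverak2011, Thm. 4.2 with Lemma 2.1, proof of Cor. 4.2 (arXiv:0911.0500 pp. 4, 7–8)] -/
theorem rusin_sverak_leray_singular_points_stable_of_unforced
    (hK : rusin_sverak_leray_weak_stability) (hPD : seregin_sverak_pressure_decay)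
    (hU : ∃ ε₀ : ℝ, 0 < ε₀ ∧ ∀ (O : Opens (ℝ × (EuclideanSpace ℝ (Fin 3)))) (u : ℝ → (EuclideanSpace ℝ (Fin 3)) → (EuclideanSpace ℝ (Fin 3))) (p : ℝ → (EuclideanSpace ℝ (Fin 3)) → ℝ),
      IsSuitableWeakSolutionOn O 1 0 u p → ∀ (z : ℝ × (EuclideanSpace ℝ (Fin 3))) (r : ℝ), 0 < r →
        closure (parabolicCylinder r z) ⊆ (O : Set (ℝ × (EuclideanSpace ℝ (Fin 3)))) →
        cknC r z u + cknD r z p ≤ ENNReal.ofReal ε₀ →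
        eLpNorm (uncurry u) ∞ (volume.restrict (parabolicCylinder (r / 2) z)) < ∞) :
    rusin_sverak_leray_singular_points_stable :=
  rusin_sverak_leray_singular_points_stable_of_weak_stability hK
    (rusin_sverak_stability_of_singularities_of_unforced hPD hU)
    (isRegularPoint_of_eLpNorm_parabolicCylinder_lt_top_of_unforced hPD hU)

/-! ### **S** and Cor. 4.2 over the leaves `K`, `P2`, `oneScaleRegularity` -/

/-- **Rusin–Šverák's weak stability of singular points** (`S = rusin_sverak_leray_singular_points_stable`,
Thm. 4.2 with Lemma 2.1 via Lemma 4.1 and Prop. 2.2) **from the weak stability of `NS(u₀)` (K), the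
pressure decay estimate (P2) and the one-scale criterion**:
`rusin_sverak_leray_singular_points_stable_of_weak_stability` with **L** and **B** supplied by
`rusin_sverak_stability_of_singularities_of_pressure_decay` and
`isRegularPoint_of_eLpNorm_parabolicCylinder_lt_top_of_pressure_decay`.
[cite: RusinSverak2011, Thm. 4.2 with Lemma 2.1, proof of Cor. 4.2 (arXiv:0911.0500 pp. 4, 7–8)] -/
theorem rusin_sverak_leray_singular_points_stable_of_pressure_decay
    (hK : rusin_sverak_leray_weak_stability) (hPD : seregin_sverak_pressure_decay)
    (hOS : oneScaleRegularity) : rusin_sverak_leray_singular_points_stable :=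
  rusin_sverak_leray_singular_points_stable_of_weak_stability hK
    (rusin_sverak_stability_of_singularities_of_pressure_decay hPD hOS)
    (isRegularPoint_of_eLpNorm_parabolicCylinder_lt_top_of_pressure_decay hPD hOS)

/-- **Rusin–Šverák's Cor. 4.2 (`rusin_sverak_weak_limit_of_singular_points`) from E, W, R, K, the
pressure decay estimate and the one-scale criterion**
(`rusin_sverak_weak_limit_of_singular_points_of_leray_theory` with **S** supplied by
`rusin_sverak_leray_singular_points_stable_of_pressure_decay`).
[cite: RusinSverak2011, Cor. 4.2 and its proof (arXiv:0911.0500 p. 8)] -/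
theorem rusin_sverak_weak_limit_of_singular_points_of_pressure_decay
    (hE : leray_solution_exists_of_memLp_three) (hW : leray_solution_ae_eq_kato)
    (hR : kato_solution_le_div_sqrt) (hK : rusin_sverak_leray_weak_stability)
    (hPD : seregin_sverak_pressure_decay) (hOS : oneScaleRegularity) :
    rusin_sverak_weak_limit_of_singular_points :=
  rusin_sverak_weak_limit_of_singular_points_of_leray_theory hE hW hR
    (rusin_sverak_leray_singular_points_stable_of_pressure_decay hK hPD hOS)

/-- **Rusin–Šverák, Cor. 4.3, second clause (`rusin_sverak_minimal_data_compact`), from the current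
leaves of the DAG**: `N′`, E, W, R, K, the pressure decay estimate, the one-scale criterion and
`kato_local` (`rusin_sverak_minimal_data_compact_of_leray_theory'`).
[cite: RusinSverak2011, Cor. 4.3 (arXiv:0911.0500 p. 8)] -/
theorem rusin_sverak_minimal_data_compact_of_pressure_decay
    (hN' : rusin_sverak_singularity_at_katoMaximalTime) (hE : leray_solution_exists_of_memLp_three)
    (hW : leray_solution_ae_eq_kato) (hR : kato_solution_le_div_sqrt)
    (hK : rusin_sverak_leray_weak_stability) (hPD : seregin_sverak_pressure_decay)
    (hOS : oneScaleRegularity) (hLoc : kato_local) : rusin_sverak_minimal_data_compact :=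
  rusin_sverak_minimal_data_compact_of_leray_theory' hN' hE hW hR
    (rusin_sverak_leray_singular_points_stable_of_pressure_decay hK hPD hOS) hLoc

end Literature.Analysis.FluidPDE

end
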